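import Summits.AtomisticToContinuum.HydrodynamicLimit.Theorems.AntiMazurCoboundariesKineticFluxLdDecaySelfTiltObjects
import Literature.Analysis.FluidPDE.HardSphereTiltWeight
import HarnessLib

/-!
# The third-cumulant comparison of the self-tilted edge covariance (stub `stub_tiltedCumulantComparison`)

Crux `Summit.AtomisticToContinuum.HydrodynamicLimit.Theses.AntiMazurCoboundaries.KineticFluxLdDecay`
(stmt-AtomisticToContinuum-10967), line `self-tilted-edge-covariance`, registered stub
`stub_tiltedCumulantComparison : TiltedCumulantComparison` (objects module
`…Theorems.AntiMazurCoboundariesKineticFluxLdDecaySelfTiltObjects`).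

For a hard-sphere flow `Φ` on `𝕋³`, a probability law `μ` carried by the good set, a bounded measurable
observable `F`, the path integral `J_u(z) = ∫₀ᵘ F(Φ_r z) dr`, the self-tilted laws `μ^{β,u} ∝ e^{βJ_u} μ`,
the edge covariance `𝒞_β(u) = Cov_{μ^{β,u}}(F∘Φ_u, F)` and the edge third cumulant
`K_β(u) = κ₃^{μ^{β,u}}(F∘Φ_u, F, J_u)`:

* `hasDerivAt_integral_mul_tiltWeight` — dominated differentiation in the tilt rate:
  `∂_β E_μ[X e^{βJ_u}] = E_μ[X J_u e^{βJ_u}]` for bounded a.e.-measurable `X`;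
* `hasDerivAt_tiltMean` — quotient rule: `∂_β E^{β,u}[X] = E^{β,u}[XJ_u] − E^{β,u}[X] E^{β,u}[J_u]`;
* `hasDerivAt_edgeCov` — **`∂_β 𝒞_β(u) = K_β(u)`** (joint-cumulant algebra);
* `aemeasurable_pathInt_prod` — `(z, u) ↦ J_u(z)` is a.e.-measurable on `phase space × time`
  (measurable in `z` on the good set, continuous in `u`; `measurable_uncurry_of_continuous_of_measurable`),
  whence `u ↦ 𝒞_β(u)` is a.e.-strongly measurable (Fubini) and, being bounded by `2C²`, interval integrable;
* `stub_tiltedCumulantComparison` — the registered statement: the mean value inequality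
  `𝒞_β(u) ≤ 𝒞_0(u) + βK` on `[0, h]` integrated over the Fejér triangle `0 ≤ u ≤ s ≤ h` gives
  `I_β(h) ≤ I_0(h) + βKh²/2`.
-/

noncomputable section

open MeasureTheory Set Filter Topology
open scoped ENNReal

namespace Summit.AtomisticToContinuum.HydrodynamicLimit.Theorems.SelfTilt

open Literature.Analysis.FluidPDE (HardSphereFlow Config)
open Literature.MathematicalPhysics.KineticTheory (T3)

variable {ε : ℝ} {n : ℕ}

/-! ## Joint measurability on `phase space × time` -/

/-- Translations of the flat torus `𝕋³` are continuous. -/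
private theorem continuous_translate_torus (x : T3) :
    Continuous ((Literature.Analysis.FluidPDE.Torus.geometry (Fin 3)).translate x) :=
  (continuous_const.add Literature.Analysis.FunctionSpaces.Torus.continuous_proj :
    Continuous fun v : EuclideanSpace ℝ (Fin 3) => x + Literature.Analysis.FunctionSpaces.Torus.proj v)

/-- A function on `phase space × time` whose restriction to `good × ℝ` is measurable is a.e.-measurable for
`μ ⊗ ν` whenever `μ` is carried by the good set and `ν` is s-finite (extend by `0` off the conull measurable
set `good × ℝ`). -/
private theorem aemeasurable_prod_of_good (Φ : TFlow ε n) {μ : Measure (TPhase n)} (hμ : μ Φ.goodᶜ = 0)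
    (ν : Measure ℝ) [SFinite ν] {G : TPhase n → ℝ → ℝ}
    (hG : Measurable fun p : Φ.good × ℝ => G (p.1 : TPhase n) p.2) :
    AEMeasurable (fun p : TPhase n × ℝ => G p.1 p.2) (μ.prod ν) := by
  classical
  -- adapted from `HardSphereFlow.aemeasurable_comp_flow_prod_torus`
  set S : Set (TPhase n × ℝ) := Φ.good ×ˢ (univ : Set ℝ) with hS
  have hSm : MeasurableSet S := Φ.measurableSet_good.prod MeasurableSet.univ
  have hGS : Measurable fun p : S => G p.1.1 p.1.2 := by
    have hmk : Measurable fun p : S => ((⟨p.1.1, (mem_prod.1 p.2).1⟩ : Φ.good), p.1.2) :=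
      ((measurable_fst.comp measurable_subtype_coe).subtype_mk).prodMk
        (measurable_snd.comp measurable_subtype_coe)
    exact hG.comp hmk
  have hG'm : Measurable fun p : TPhase n × ℝ => if hp : p ∈ S then G p.1 p.2 else 0 :=
    Measurable.dite (s := S) (f := fun p : S => G p.1.1 p.1.2) (g := fun _ => (0 : ℝ)) hGS
      measurable_const hSm
  have hSc : (μ.prod ν) Sᶜ = 0 := by
    have hsub : Sᶜ ⊆ Φ.goodᶜ ×ˢ (univ : Set ℝ) := by
      intro p hp
      simp only [hS, mem_compl_iff, mem_prod, mem_univ, and_true] at hp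
      exact ⟨hp, mem_univ _⟩
    refine measure_mono_null hsub ?_
    rw [Measure.prod_prod, hμ, zero_mul]
  refine ⟨_, hG'm, ?_⟩
  filter_upwards [(mem_ae_iff.2 hSc : ∀ᵐ p ∂(μ.prod ν), p ∈ S)] with p hp
  simp only [hp, dite_true]

/-- **`(z, u) ↦ J_u(z)` is a.e.-measurable on `phase space × time`** (`μ` carried by the good set, `ν`
s-finite): on the good set it is measurable in `z` for each `u` (Fubini measurability after
`HardSphereFlow.measurable_flow_prod_torus`) and continuous in `u` for each `z` (primitive of a bounded
measurable orbit function), so `measurable_uncurry_of_continuous_of_measurable` applies on `ℝ × good`. -/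
theorem aemeasurable_pathInt_prod (Φ : TFlow ε n) {μ : Measure (TPhase n)} (hμ : μ Φ.goodᶜ = 0)
    (ν : Measure ℝ) [SFinite ν] {F : TPhase n → ℝ} (hF : Measurable F) {C : ℝ} (hC : ∀ z, |F z| ≤ C) :
    AEMeasurable (fun p : TPhase n × ℝ => pathInt Φ F p.2 p.1) (μ.prod ν) := by
  have hG : ∀ x : T3, Continuous ((Literature.Analysis.FluidPDE.Torus.geometry (Fin 3)).translate x) :=
    continuous_translate_torus
  have hmeas : ∀ u : ℝ, Measurable fun z : Φ.good => pathInt Φ F u z := by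
    intro u
    have h1 := (Φ.stronglyMeasurable_integral_comp_flow hG hF.stronglyMeasurable
      (volume.restrict (Ioc 0 u))).measurable
    have h2 := (Φ.stronglyMeasurable_integral_comp_flow hG hF.stronglyMeasurable
      (volume.restrict (Ioc u 0))).measurable
    show Measurable fun z : Φ.good => ∫ r in (0 : ℝ)..u, F (Φ.flow r z)
    simp only [intervalIntegral]
    exact h1.sub h2
  have hcont : ∀ z : Φ.good, Continuous fun u => pathInt Φ F u z := fun z =>
    intervalIntegral.continuous_primitive
      (fun a b => Φ.intervalIntegrable_comp_flow_of_bounded z.2 hF hC a b) 0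
  have hunc : Measurable (Function.uncurry fun (u : ℝ) (z : Φ.good) => pathInt Φ F u z) :=
    measurable_uncurry_of_continuous_of_measurable hcont hmeas
  refine aemeasurable_prod_of_good Φ hμ ν (G := fun z u => pathInt Φ F u z) ?_
  exact hunc.comp measurable_swap

/-- `(z, u) ↦ e^{βJ_u(z)}` is a.e.-measurable on `phase space × time`. -/
theorem aemeasurable_tiltWeight_prod (Φ : TFlow ε n) {μ : Measure (TPhase n)} (hμ : μ Φ.goodᶜ = 0)
    (ν : Measure ℝ) [SFinite ν] {F : TPhase n → ℝ} (hF : Measurable F) {C : ℝ} (hC : ∀ z, |F z| ≤ C)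
    (β : ℝ) : AEMeasurable (fun p : TPhase n × ℝ => tiltWeight Φ F β p.2 p.1) (μ.prod ν) :=
  Real.measurable_exp.comp_aemeasurable ((aemeasurable_pathInt_prod Φ hμ ν hF hC).const_mul β)

/-- **Fubini measurability of the tilted moments in the window**: for `X` a.e.-measurable on
`phase space × time`, `u ↦ ∫ X(z, u) e^{βJ_u(z)} dμ` is a.e.-strongly measurable. -/
theorem aestronglyMeasurable_integral_mul_tiltWeight (Φ : TFlow ε n) {μ : Measure (TPhase n)}
    [SFinite μ] (hμ : μ Φ.goodᶜ = 0) {F : TPhase n → ℝ} (hF : Measurable F) {C : ℝ}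
    (hC : ∀ z, |F z| ≤ C) (β : ℝ) {X : TPhase n × ℝ → ℝ} (hX : AEMeasurable X (μ.prod volume)) :
    AEStronglyMeasurable (fun u => ∫ z, X (z, u) * tiltWeight Φ F β u z ∂μ) volume := by
  have h1 : AEStronglyMeasurable (fun p : ℝ × TPhase n => X (p.2, p.1) * tiltWeight Φ F β p.1 p.2)
      (volume.prod μ) :=
    (hX.mul (aemeasurable_tiltWeight_prod Φ hμ volume hF hC β)).prod_swap.aestronglyMeasurable
  exact h1.integral_prod_right'

/-! ## Bounds: positivity of the normalisation, tilted means of bounded observables -/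

/-- The tilt normalisation `E_μ e^{βJ_u}` is positive (probability law carried by the good set). -/
theorem integral_tiltWeight_pos (Φ : TFlow ε n) (μ : Measure (TPhase n)) [IsProbabilityMeasure μ]
    (hμ : μ Φ.goodᶜ = 0) {F : TPhase n → ℝ} (hF : Measurable F) {C : ℝ} (hC : ∀ z, |F z| ≤ C)
    (β u : ℝ) : 0 < ∫ z, tiltWeight Φ F β u z ∂μ :=
  (Real.exp_pos _).trans_le (stub_selfTiltObjects ε n Φ μ inferInstance hμ F hF C hC β u).1

/-- Integrability of `X e^{βJ_u}` for bounded a.e.-measurable `X`. -/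
theorem integrable_mul_tiltWeight (Φ : TFlow ε n) {μ : Measure (TPhase n)} [IsFiniteMeasure μ]
    (hμ : μ Φ.goodᶜ = 0) {F : TPhase n → ℝ} (hF : Measurable F) {C : ℝ} (hC : ∀ z, |F z| ≤ C)
    {X : TPhase n → ℝ} (hXm : AEMeasurable X μ) {K : ℝ} (hXK : ∀ z, |X z| ≤ K) (β u : ℝ) :
    Integrable (fun z => X z * tiltWeight Φ F β u z) μ :=
  Φ.integrable_mul_tilt hμ hF hC hXm hXK β u

/-- A tilted mean of an observable bounded by `K` is bounded by `K` (no measurability needed: a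
non-integrable numerator is the junk value `0`). -/
theorem abs_tiltMean_le (Φ : TFlow ε n) (μ : Measure (TPhase n)) [IsProbabilityMeasure μ]
    (hμ : μ Φ.goodᶜ = 0) {F : TPhase n → ℝ} (hF : Measurable F) {C : ℝ} (hC : ∀ z, |F z| ≤ C)
    {X : TPhase n → ℝ} {K : ℝ} (hXK : ∀ z, |X z| ≤ K) (β u : ℝ) : |tiltMean Φ μ F β u X| ≤ K := by
  have hZ := integral_tiltWeight_pos Φ μ hμ hF hC β u
  have hnum : |∫ z, X z * tiltWeight Φ F β u z ∂μ| ≤ K * ∫ z, tiltWeight Φ F β u z ∂μ := by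
    have h := norm_integral_le_of_norm_le (μ := μ) (f := fun z => X z * tiltWeight Φ F β u z)
      (g := fun z => K * tiltWeight Φ F β u z) ((integrable_tiltWeight Φ hμ hF hC β u).const_mul K)
      (ae_of_all _ fun z => by
        rw [Real.norm_eq_abs, abs_mul, abs_of_pos (tiltWeight_pos Φ F β u z)]
        exact mul_le_mul_of_nonneg_right (hXK z) (tiltWeight_pos Φ F β u z).le)
    rw [integral_const_mul] at h
    simpa only [Real.norm_eq_abs] using h
  rw [tiltMean, abs_div, abs_of_pos hZ, div_le_iff₀ hZ]
  exact hnum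

/-- `|𝒞_β(u)| ≤ 2C²`. -/
theorem abs_edgeCov_le (Φ : TFlow ε n) (μ : Measure (TPhase n)) [IsProbabilityMeasure μ]
    (hμ : μ Φ.goodᶜ = 0) {F : TPhase n → ℝ} (hF : Measurable F) {C : ℝ} (hC : ∀ z, |F z| ≤ C)
    (β u : ℝ) : |edgeCov Φ μ F β u| ≤ C * C + C * C := by
  have hC0 : 0 ≤ C := (abs_nonneg _).trans (hC (Classical.arbitrary _))
  have h1 : |tiltMean Φ μ F β u (fun z => F (Φ.flow u z) * F z)| ≤ C * C :=
    abs_tiltMean_le Φ μ hμ hF hC (fun z => by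
      rw [abs_mul]
      exact mul_le_mul (hC _) (hC z) (abs_nonneg _) hC0) β u
  have h2 : |tiltMean Φ μ F β u (fun z => F (Φ.flow u z))| ≤ C :=
    abs_tiltMean_le Φ μ hμ hF hC (fun z => hC _) β u
  have h3 : |tiltMean Φ μ F β u F| ≤ C := abs_tiltMean_le Φ μ hμ hF hC hC β u
  rw [edgeCov]
  refine (abs_sub _ _).trans (add_le_add h1 ?_)
  rw [abs_mul]
  exact mul_le_mul h2 h3 (abs_nonneg _) hC0

/-! ## Measurability and interval integrability of `u ↦ 𝒞_β(u)` -/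

/-- `u ↦ 𝒞_β(u)` is a.e.-strongly measurable (Fubini measurability of the four tilted moments). -/
theorem aestronglyMeasurable_edgeCov (Φ : TFlow ε n) {μ : Measure (TPhase n)} [SFinite μ]
    (hμ : μ Φ.goodᶜ = 0) {F : TPhase n → ℝ} (hF : Measurable F) {C : ℝ} (hC : ∀ z, |F z| ≤ C)
    (β : ℝ) : AEStronglyMeasurable (fun u => edgeCov Φ μ F β u) volume := by
  have hflow : AEMeasurable (fun p : TPhase n × ℝ => F (Φ.flow p.2 p.1)) (μ.prod volume) :=
    Φ.aemeasurable_comp_flow_prod_torus hμ volume (0 : ℝ) hF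
  have hfst : AEMeasurable (fun p : TPhase n × ℝ => F p.1) (μ.prod volume) :=
    (hF.comp measurable_fst).aemeasurable
  have hAB := (aestronglyMeasurable_integral_mul_tiltWeight Φ hμ hF hC β (hflow.fun_mul hfst)).aemeasurable
  have hA := (aestronglyMeasurable_integral_mul_tiltWeight Φ hμ hF hC β hflow).aemeasurable
  have hB := (aestronglyMeasurable_integral_mul_tiltWeight Φ hμ hF hC β hfst).aemeasurable
  have hZ := (aestronglyMeasurable_integral_mul_tiltWeight Φ hμ hF hC β
    (aemeasurable_const (b := (1 : ℝ)) (μ := μ.prod volume))).aemeasurable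
  simp only [one_mul] at hZ
  have h := (hAB.fun_div hZ).fun_sub ((hA.fun_div hZ).fun_mul (hB.fun_div hZ))
  simpa only [edgeCov, tiltMean] using h.aestronglyMeasurable

/-- `u ↦ 𝒞_β(u)` is interval integrable on every interval (bounded by `2C²` and a.e.-strongly measurable). -/
theorem intervalIntegrable_edgeCov (Φ : TFlow ε n) (μ : Measure (TPhase n)) [IsProbabilityMeasure μ]
    (hμ : μ Φ.goodᶜ = 0) {F : TPhase n → ℝ} (hF : Measurable F) {C : ℝ} (hC : ∀ z, |F z| ≤ C)
    (β a b : ℝ) : IntervalIntegrable (fun u => edgeCov Φ μ F β u) volume a b :=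
  (intervalIntegrable_const (c := C * C + C * C)).mono_fun'
    (aestronglyMeasurable_edgeCov Φ hμ hF hC β).restrict
    (ae_of_all _ fun u => by simpa only [Real.norm_eq_abs] using abs_edgeCov_le Φ μ hμ hF hC β u)

/-! ## Differentiation in the tilt rate -/

/-- **Differentiation of the tilted moments in the tilt rate** (dominated differentiation): for a bounded
a.e.-measurable `X`, `β ↦ E_μ[X e^{βJ_u}]` has derivative `E_μ[X J_u e^{βJ_u}]` at every `β₀`
(`|J_u| ≤ |u|C`, so on the ball `|β − β₀| < 1` the derivative is dominated by the constant
`K |u| C e^{(|β₀|+1)|u|C}`). -/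
theorem hasDerivAt_integral_mul_tiltWeight (Φ : TFlow ε n) {μ : Measure (TPhase n)}
    [IsFiniteMeasure μ] (hμ : μ Φ.goodᶜ = 0) {F : TPhase n → ℝ} (hF : Measurable F) {C : ℝ}
    (hC : ∀ z, |F z| ≤ C) {X : TPhase n → ℝ} (hXm : AEMeasurable X μ) {K : ℝ}
    (hXK : ∀ z, |X z| ≤ K) (u β₀ : ℝ) :
    HasDerivAt (fun β => ∫ z, X z * tiltWeight Φ F β u z ∂μ)
      (∫ z, X z * pathInt Φ F u z * tiltWeight Φ F β₀ u z ∂μ) β₀ := by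
  have hK0 : 0 ≤ K := (abs_nonneg _).trans (hXK (Classical.arbitrary _))
  have hC0 : 0 ≤ C := (abs_nonneg _).trans (hC (Classical.arbitrary _))
  have hJ : ∀ z, |pathInt Φ F u z| ≤ |u| * C := abs_pathInt_le Φ hC u
  have hWle : ∀ β ∈ Metric.ball β₀ 1, ∀ z,
      tiltWeight Φ F β u z ≤ Real.exp ((|β₀| + 1) * (|u| * C)) := by
    intro β hβ z
    refine (tiltWeight_le Φ hC β u z).2.trans (Real.exp_le_exp.2 ?_)
    have h1 : |β - β₀| < 1 := by rwa [Metric.mem_ball, Real.dist_eq] at hβ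
    have h2 : |β| - |β₀| ≤ |β - β₀| := abs_sub_abs_le_abs_sub β β₀
    exact mul_le_mul_of_nonneg_right (by linarith) (mul_nonneg (abs_nonneg u) hC0)
  have hdiff : ∀ z β, HasDerivAt (fun β => X z * tiltWeight Φ F β u z)
      (X z * pathInt Φ F u z * tiltWeight Φ F β u z) β := by
    intro z β
    show HasDerivAt (fun β => X z * Real.exp (β * pathInt Φ F u z))
      (X z * pathInt Φ F u z * Real.exp (β * pathInt Φ F u z)) β
    refine ((hasDerivAt_mul_const (x := β) (pathInt Φ F u z)).exp.const_mul (X z)).congr_deriv ?_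
    ring
  refine (hasDerivAt_integral_of_dominated_loc_of_deriv_le (μ := μ) (x₀ := β₀)
    (F := fun β z => X z * tiltWeight Φ F β u z)
    (F' := fun β z => X z * pathInt Φ F u z * tiltWeight Φ F β u z)
    (bound := fun _ => K * (|u| * C) * Real.exp ((|β₀| + 1) * (|u| * C)))
    (Metric.ball_mem_nhds β₀ one_pos) ?_ ?_ ?_ ?_ (integrable_const _) ?_).2
  · exact Eventually.of_forall fun β =>
      (hXm.mul (aemeasurable_tiltWeight Φ hμ hF β u)).aestronglyMeasurable
  · exact integrable_mul_tiltWeight Φ hμ hF hC hXm hXK β₀ u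
  · exact ((hXm.mul (aemeasurable_pathInt Φ hμ hF u)).mul
      (aemeasurable_tiltWeight Φ hμ hF β₀ u)).aestronglyMeasurable
  · refine ae_of_all _ fun z β hβ => ?_
    rw [Real.norm_eq_abs, abs_mul, abs_mul, abs_of_pos (tiltWeight_pos Φ F β u z)]
    exact mul_le_mul (mul_le_mul (hXK z) (hJ z) (abs_nonneg _) hK0) (hWle β hβ z)
      (tiltWeight_pos Φ F β u z).le (mul_nonneg hK0 (mul_nonneg (abs_nonneg u) hC0))
  · exact ae_of_all _ fun z β _ => hdiff z β

/-- **Derivative of a tilted mean in the tilt rate** (quotient rule; the normalisation is `> 0`):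
`∂_β E^{β,u}[X] = E^{β,u}[X J_u] − E^{β,u}[X] E^{β,u}[J_u]`. -/
theorem hasDerivAt_tiltMean (Φ : TFlow ε n) (μ : Measure (TPhase n)) [IsProbabilityMeasure μ]
    (hμ : μ Φ.goodᶜ = 0) {F : TPhase n → ℝ} (hF : Measurable F) {C : ℝ} (hC : ∀ z, |F z| ≤ C)
    {X : TPhase n → ℝ} (hXm : AEMeasurable X μ) {K : ℝ} (hXK : ∀ z, |X z| ≤ K) (u β₀ : ℝ) :
    HasDerivAt (fun β => tiltMean Φ μ F β u X)
      (tiltMean Φ μ F β₀ u (fun z => X z * pathInt Φ F u z) -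
        tiltMean Φ μ F β₀ u X * tiltMean Φ μ F β₀ u (pathInt Φ F u)) β₀ := by
  have hN := hasDerivAt_integral_mul_tiltWeight Φ hμ hF hC hXm hXK u β₀
  have hZ' := hasDerivAt_integral_mul_tiltWeight Φ hμ hF hC
    (aemeasurable_const (b := (1 : ℝ)) (μ := μ)) (K := 1) (fun _ => by rw [abs_one]) u β₀
  simp only [one_mul] at hZ'
  have hZpos := integral_tiltWeight_pos Φ μ hμ hF hC β₀ u
  have hZne : (∫ z, tiltWeight Φ F β₀ u z ∂μ) ≠ 0 := hZpos.ne'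
  have h := hN.fun_div hZ' hZne
  simp only [tiltMean]
  refine h.congr_deriv ?_
  field_simp

/-- **`∂_β 𝒞_β(u) = K_β(u)`**: the β-derivative of the tilted edge covariance
`E^{β,u}[F∘Φ_u · F] − E^{β,u}[F∘Φ_u] E^{β,u}[F]` is the joint third cumulant `κ₃^{μ^{β,u}}(F∘Φ_u, F, J_u)`
(product rule on `hasDerivAt_tiltMean` and the joint-cumulant algebra). -/
theorem hasDerivAt_edgeCov (Φ : TFlow ε n) (μ : Measure (TPhase n)) [IsProbabilityMeasure μ]
    (hμ : μ Φ.goodᶜ = 0) {F : TPhase n → ℝ} (hF : Measurable F) {C : ℝ} (hC : ∀ z, |F z| ≤ C)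
    (u β₀ : ℝ) : HasDerivAt (fun β => edgeCov Φ μ F β u) (edgeCum Φ μ F β₀ u) β₀ := by
  have hC0 : 0 ≤ C := (abs_nonneg _).trans (hC (Classical.arbitrary _))
  have hAm : AEMeasurable (fun z => F (Φ.flow u z)) μ := (hF.comp (Φ.measurable_flow u)).aemeasurable
  have hAK : ∀ z, |F (Φ.flow u z)| ≤ C := fun z => hC _
  have hABm : AEMeasurable (fun z => F (Φ.flow u z) * F z) μ := hAm.mul hF.aemeasurable
  have hABK : ∀ z, |F (Φ.flow u z) * F z| ≤ C * C := fun z => by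
    rw [abs_mul]
    exact mul_le_mul (hC _) (hC z) (abs_nonneg _) hC0
  have hAB := hasDerivAt_tiltMean Φ μ hμ hF hC hABm hABK u β₀
  have hA := hasDerivAt_tiltMean Φ μ hμ hF hC hAm hAK u β₀
  have hB := hasDerivAt_tiltMean Φ μ hμ hF hC hF.aemeasurable hC u β₀
  have h := hAB.fun_sub (hA.fun_mul hB)
  show HasDerivAt (fun β => tiltMean Φ μ F β u (fun z => F (Φ.flow u z) * F z) -
    tiltMean Φ μ F β u (fun z => F (Φ.flow u z)) * tiltMean Φ μ F β u F) (edgeCum Φ μ F β₀ u) β₀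
  refine h.congr_deriv ?_
  rw [edgeCum]
  ring

/-! ## The mean value step and the registered stub -/

/-- Mean value step: if `|K_{β'}(u)| ≤ K` for `β' ∈ [0, β]` then `𝒞_β(u) ≤ 𝒞_0(u) + βK`. -/
theorem edgeCov_le_of_abs_edgeCum_le (Φ : TFlow ε n) (μ : Measure (TPhase n))
    [IsProbabilityMeasure μ] (hμ : μ Φ.goodᶜ = 0) {F : TPhase n → ℝ} (hF : Measurable F) {C : ℝ}
    (hC : ∀ z, |F z| ≤ C) (u : ℝ) {β K : ℝ} (hβ : 0 ≤ β)
    (hK : ∀ β' ∈ Icc (0 : ℝ) β, |edgeCum Φ μ F β' u| ≤ K) :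
    edgeCov Φ μ F β u ≤ edgeCov Φ μ F 0 u + β * K := by
  have h := norm_image_sub_le_of_norm_deriv_le_segment' (f := fun β' => edgeCov Φ μ F β' u)
    (f' := fun β' => edgeCum Φ μ F β' u) (a := 0) (b := β) (C := K)
    (fun x _ => (hasDerivAt_edgeCov Φ μ hμ hF hC u x).hasDerivWithinAt)
    (fun x hx => by simpa only [Real.norm_eq_abs] using hK x (Ico_subset_Icc_self hx)) β
    ⟨hβ, le_rfl⟩
  rw [Real.norm_eq_abs, sub_zero] at h
  have h2 := (abs_le.1 h).2
  linarith

/-- **Registered stub `stub_tiltedCumulantComparison` — the third-cumulant comparison.** For every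
hard-sphere flow `Φ` on `𝕋³`, every `Φ`-invariant probability law `μ` carried by the good set, every bounded
measurable `F`, `β ≥ 0`, `h > 0` and `K`: if `|κ₃^{μ^{β',u}}(F∘Φ_u, F, J_u)| ≤ K` for all `u ∈ [0, h]`,
`β' ∈ [0, β]`, then `I_β(h) ≤ I_0(h) + βKh²/2`. Proof: `∂_β 𝒞_β(u) = K_β(u)` (`hasDerivAt_edgeCov`), the
mean value inequality on `[0, β]` gives `𝒞_β(u) ≤ 𝒞_0(u) + βK` for `u ∈ [0, h]`, and two monotone
interval integrations over the Fejér triangle `0 ≤ u ≤ s ≤ h` (`u ↦ 𝒞_β(u)` is bounded and measurable,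
`intervalIntegrable_edgeCov`) give `∫₀ʰ∫₀ˢ 𝒞_β ≤ ∫₀ʰ∫₀ˢ 𝒞_0 + ∫₀ʰ βKs ds = I_0(h) + βKh²/2`.
(Invariance of `μ` is not used.) -/
theorem stub_tiltedCumulantComparison : TiltedCumulantComparison := by
  intro ε n Φ μ hμP _hinv hgood F hF hFb β h K hβ hh hK
  obtain ⟨C, hC⟩ := hFb
  -- the mean value bound on `[0, h]`
  have hpt : ∀ u ∈ Icc (0 : ℝ) h, edgeCov Φ μ F β u ≤ edgeCov Φ μ F 0 u + β * K := fun u hu =>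
    edgeCov_le_of_abs_edgeCum_le Φ μ hgood hF hC u hβ (hK u hu)
  have hgi : ∀ β' a b, IntervalIntegrable (fun u => edgeCov Φ μ F β' u) volume a b := fun β' a b =>
    intervalIntegrable_edgeCov Φ μ hgood hF hC β' a b
  -- inner integration over `u ∈ [0, s]`
  have hin : ∀ s ∈ Icc (0 : ℝ) h, ∫ u in (0 : ℝ)..s, edgeCov Φ μ F β u ≤
      (∫ u in (0 : ℝ)..s, edgeCov Φ μ F 0 u) + β * K * s := by
    intro s hs
    calc ∫ u in (0 : ℝ)..s, edgeCov Φ μ F β u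
        ≤ ∫ u in (0 : ℝ)..s, (edgeCov Φ μ F 0 u + β * K) :=
          intervalIntegral.integral_mono_on hs.1 (hgi β 0 s) ((hgi 0 0 s).add intervalIntegrable_const)
            fun u hu => hpt u ⟨hu.1, hu.2.trans hs.2⟩
      _ = (∫ u in (0 : ℝ)..s, edgeCov Φ μ F 0 u) + β * K * s := by
          rw [intervalIntegral.integral_add (hgi 0 0 s) intervalIntegrable_const,
            intervalIntegral.integral_const, sub_zero, smul_eq_mul]
          ring
  -- outer integration over `s ∈ [0, h]`
  have hprim : ∀ β', Continuous fun s => ∫ u in (0 : ℝ)..s, edgeCov Φ μ F β' u := fun β' =>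
    intervalIntegral.continuous_primitive (hgi β') 0
  have hlin : Continuous fun s : ℝ => β * K * s := continuous_const.mul continuous_id
  have h2 : ∫ s in (0 : ℝ)..h, (∫ u in (0 : ℝ)..s, edgeCov Φ μ F β u) ≤
      ∫ s in (0 : ℝ)..h, ((∫ u in (0 : ℝ)..s, edgeCov Φ μ F 0 u) + β * K * s) :=
    intervalIntegral.integral_mono_on hh.le ((hprim β).intervalIntegrable 0 h)
      (((hprim 0).add hlin).intervalIntegrable 0 h) hin
  rw [intervalIntegral.integral_add ((hprim 0).intervalIntegrable 0 h) (hlin.intervalIntegrable 0 h),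
    intervalIntegral.integral_const_mul, integral_id] at h2
  have e : β * K * ((h ^ 2 - 0 ^ 2) / 2) = β * K * h ^ 2 / 2 := by ring
  show (∫ s in (0 : ℝ)..h, ∫ u in (0 : ℝ)..s, edgeCov Φ μ F β u) ≤
    (∫ s in (0 : ℝ)..h, ∫ u in (0 : ℝ)..s, edgeCov Φ μ F 0 u) + β * K * h ^ 2 / 2
  linarith

end Summit.AtomisticToContinuum.HydrodynamicLimit.Theorems.SelfTilt

end
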